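import Literature.RepresentationTheory.KonnoKonno2007.RealUnitaryDualPair
import Mathlib.Analysis.Matrix.PosDef
import Mathlib.LinearAlgebra.Matrix.SchurComplement
import HarnessLib

/-!
# The bounded domain `{Z : 1 − ZᴴZ ≻ 0}` of `U(α, β)`, its Möbius action, and the block identities behind
# the canonical automorphy factors (kernel algebra for the general-rank `det^{1/2}`-cover identification)

Topic `NumberTheory/Weil1964`; namespace `Literature.NumberTheory.Weil1964.UnitaryBall`.  KERNEL throughout:
definitions with bodies and proved theorems — no records, no `sorry`, no cited hypothesis.

For the indefinite unitary group `U(α, β) = U(⋆, diag(1_α, −1_β))` of the tree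
(`KonnoKonno2007.RealDualPair.UForm α β`, block form `G = (a b; c d)`, `a : α × α`, `d : β × β`) this file proves the
finite-dimensional matrix algebra of its action on the bounded realisation of its symmetric space,
`𝒟_{α,β} = {Z ∈ M_{α×β}(ℂ) : 1 − ZᴴZ ≻ 0}` (the maximal negative subspaces `V_Z⁻ = {(Zy, y)}` of `ℂ^α ⊕ ℂ^β`),
`G·Z = (aZ + b)(cZ + d)⁻¹`:

* §1 blocks and the unitarity relations `aᴴa − cᴴc = 1`, `aᴴb = cᴴd`, `dᴴd − bᴴb = 1`, `aaᴴ − bbᴴ = 1`,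
  `ddᴴ − ccᴴ = 1`, `acᴴ = bdᴴ`; `a`, `d` are invertible; `|det G| = 1`; `|det a| = |det d|`;
* §2 the domain `ball α β`, invertibility of `cZ + d` on it, the Möbius map `moebius G Z` and `moebius G Z ∈ ball`,
  `moebius G 0 = b d⁻¹`, `(b d⁻¹)ᴴ = c a⁻¹`;
* the sequel `ArchUnitaryBallFrame` proves the ISOTROPY IDENTITY `c + dZᴴ = (G·Z)ᴴ (a + bZᴴ)`, the FRAME IDENTITY
  `G · (1 Z; Zᴴ 1) = (1 Z′; Z′ᴴ 1) · diag(a + bZᴴ, cZ + d)` and its determinant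
  `det G · det(1 − ZᴴZ) = det(1 − Z′ᴴZ′) · det(a + bZᴴ) · det(cZ + d)`, and the blocks of a product.

These are the inputs of `ArchUnitarySiegelEmbedding` (the `U(α,β)`-equivariant map into the Siegel half-space and the
factorisation of Folland's automorphy factor `j(g, τ)` along it) and of `ArchMetaplecticUnitaryDetCharacter` (the
genuine character `det^{1/2}` of the metaplectic two-fold cover over `U(α, β)` at every real rank).  Sources: the
group `U(α, β)` and the dual-pair conventions are those of [MoeglinVignerasWaldspurger1987, Ch. 1 I.17] (as in the tree's
`RealUnitaryDualPair`); the action on the bounded domain with its canonical automorphy factors `a + bZᴴ`, `cZ + d` is the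
`G = U(α, β)` instance of the Harish-Chandra decomposition `g · exp Z = exp(g·Z) · J(g, Z) · (…)` of [Lee2004, §6.3
(6.27)–(6.30)] (originally [Satake1965]); the proofs are elementary block-matrix algebra.

## References

* [Folland1989] G. B. Folland, *Harmonic Analysis in Phase Space*, Princeton UP 1989, §4.5.
* [Paul1998] A. Paul, *Howe correspondence for real unitary groups*, J. Funct. Anal. 159 (1998), §1.1–§1.2.
-/

set_option autoImplicit false

noncomputable section

open Matrix Complex
open scoped ComplexOrder ComplexConjugate

namespace Literature.NumberTheory.Weil1964

open Literature.RepresentationTheory.KonnoKonno2007 Literature.RepresentationTheory.KonnoKonno2007.RealDualPair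
open Literature.NumberTheory.Automorphic Literature.NumberTheory.Automorphic.UnitaryGroup

namespace UnitaryBall

variable {α β : Type*} [Fintype α] [DecidableEq α] [Fintype β] [DecidableEq β]

/-! ## 1. Blocks of `G ∈ U(α, β)` and the unitarity relations -/

/-- The matrix of `G ∈ U(α, β)`. [folklore] -/
abbrev mat (G : UForm α β) : Matrix (α ⊕ β) (α ⊕ β) ℂ := ((G : GL (α ⊕ β) ℂ) : Matrix (α ⊕ β) (α ⊕ β) ℂ)

/-- The block `a : α × α` of `G = (a b; c d)`. [folklore] -/
def a (G : UForm α β) : Matrix α α ℂ := (mat G).toBlocks₁₁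
/-- The block `b : α × β` of `G = (a b; c d)`. [folklore] -/
def b (G : UForm α β) : Matrix α β ℂ := (mat G).toBlocks₁₂
/-- The block `c : β × α` of `G = (a b; c d)`. [folklore] -/
def c (G : UForm α β) : Matrix β α ℂ := (mat G).toBlocks₂₁
/-- The block `d : β × β` of `G = (a b; c d)`. [folklore] -/
def d (G : UForm α β) : Matrix β β ℂ := (mat G).toBlocks₂₂

/-- `G = (a b; c d)`. [cite: MoeglinVignerasWaldspurger1987, Ch. 1 I.17] -/
theorem mat_eq_fromBlocks (G : UForm α β) : mat G = fromBlocks (a G) (b G) (c G) (d G) :=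
  (fromBlocks_toBlocks _).symm

/-- `mat 1 = 1`. [cite: MoeglinVignerasWaldspurger1987, Ch. 1 I.17] -/
@[simp] theorem mat_one : mat (1 : UForm α β) = 1 := rfl

/-- `mat (G G′) = mat G · mat G′`. [cite: MoeglinVignerasWaldspurger1987, Ch. 1 I.17] -/
@[simp] theorem mat_mul (G G' : UForm α β) : mat (G * G') = mat G * mat G' := rfl

/-- **Unitarity**: `Gᴴ · diag(1, −1) · G = diag(1, −1)`. [cite: MoeglinVignerasWaldspurger1987, Ch. 1 I.17] -/
theorem conjTranspose_mul_signForm_mul (G : UForm α β) : (mat G)ᴴ * signForm α β * mat G = signForm α β :=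
  (mem_unitaryGroupOfForm_star_iff_conjTranspose _ _).1 G.2

/-- **Unitarity, transposed form**: `G · diag(1, −1) · Gᴴ = diag(1, −1)` (a left inverse is a right inverse).
[cite: MoeglinVignerasWaldspurger1987, Ch. 1 I.17] -/
theorem mul_signForm_mul_conjTranspose (G : UForm α β) : mat G * signForm α β * (mat G)ᴴ = signForm α β := by
  have hD2 : signForm α β * signForm α β = 1 := by
    rw [Matrix.fromBlocks_multiply]
    simp
  have h1 : (signForm α β * (mat G)ᴴ * signForm α β) * mat G = 1 := by
    calc (signForm α β * (mat G)ᴴ * signForm α β) * mat G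
        = signForm α β * ((mat G)ᴴ * signForm α β * mat G) := by simp only [Matrix.mul_assoc]
      _ = 1 := by rw [conjTranspose_mul_signForm_mul, hD2]
  have h2 : mat G * (signForm α β * (mat G)ᴴ * signForm α β) = 1 := mul_eq_one_comm.1 h1
  calc mat G * signForm α β * (mat G)ᴴ
      = mat G * signForm α β * (mat G)ᴴ * (signForm α β * signForm α β) := by rw [hD2, Matrix.mul_one]
    _ = (mat G * (signForm α β * (mat G)ᴴ * signForm α β)) * signForm α β := by simp only [Matrix.mul_assoc]
    _ = signForm α β := by rw [h2, Matrix.one_mul]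

/-- The four block relations of `Gᴴ D G = D`: `aᴴa − cᴴc = 1`, `aᴴb − cᴴd = 0`, `bᴴa − dᴴc = 0`, `bᴴb − dᴴd = −1`.
[cite: MoeglinVignerasWaldspurger1987, Ch. 1 I.17] -/
theorem block_relations (G : UForm α β) :
    (a G)ᴴ * a G - (c G)ᴴ * c G = 1 ∧ (a G)ᴴ * b G - (c G)ᴴ * d G = 0 ∧
      (b G)ᴴ * a G - (d G)ᴴ * c G = 0 ∧ (b G)ᴴ * b G - (d G)ᴴ * d G = -1 := by
  have h := conjTranspose_mul_signForm_mul G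
  rw [mat_eq_fromBlocks, Matrix.fromBlocks_conjTranspose, Matrix.fromBlocks_multiply,
    Matrix.fromBlocks_multiply] at h
  simp only [Matrix.mul_one, Matrix.mul_zero, add_zero, zero_add, Matrix.mul_neg, Matrix.neg_mul] at h
  obtain ⟨h11, h12, h21, h22⟩ := Matrix.fromBlocks_inj.1 h
  refine ⟨?_, ?_, ?_, ?_⟩
  · rw [sub_eq_add_neg]; exact h11
  · rw [sub_eq_add_neg]; exact h12
  · rw [sub_eq_add_neg]; exact h21
  · rw [sub_eq_add_neg]; exact h22

/-- The four block relations of `G D Gᴴ = D`: `aaᴴ − bbᴴ = 1`, `acᴴ − bdᴴ = 0`, `caᴴ − dbᴴ = 0`, `ccᴴ − ddᴴ = −1`.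
[cite: MoeglinVignerasWaldspurger1987, Ch. 1 I.17] -/
theorem block_relations' (G : UForm α β) :
    a G * (a G)ᴴ - b G * (b G)ᴴ = 1 ∧ a G * (c G)ᴴ - b G * (d G)ᴴ = 0 ∧
      c G * (a G)ᴴ - d G * (b G)ᴴ = 0 ∧ c G * (c G)ᴴ - d G * (d G)ᴴ = -1 := by
  have h := mul_signForm_mul_conjTranspose G
  rw [mat_eq_fromBlocks, Matrix.fromBlocks_conjTranspose, Matrix.fromBlocks_multiply,
    Matrix.fromBlocks_multiply] at h
  simp only [Matrix.mul_one, Matrix.mul_zero, add_zero, zero_add, Matrix.mul_neg, Matrix.neg_mul] at h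
  obtain ⟨h11, h12, h21, h22⟩ := Matrix.fromBlocks_inj.1 h
  refine ⟨?_, ?_, ?_, ?_⟩
  · rw [sub_eq_add_neg]; exact h11
  · rw [sub_eq_add_neg]; exact h12
  · rw [sub_eq_add_neg]; exact h21
  · rw [sub_eq_add_neg]; exact h22

/-- `aᴴa = 1 + cᴴc`. [cite: MoeglinVignerasWaldspurger1987, Ch. 1 I.17] -/
theorem conjTranspose_a_mul_a (G : UForm α β) : (a G)ᴴ * a G = 1 + (c G)ᴴ * c G := by
  have h := (block_relations G).1
  rw [sub_eq_iff_eq_add] at h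
  exact h

/-- `dᴴd = 1 + bᴴb`. [cite: MoeglinVignerasWaldspurger1987, Ch. 1 I.17] -/
theorem conjTranspose_d_mul_d (G : UForm α β) : (d G)ᴴ * d G = 1 + (b G)ᴴ * b G := by
  have h := (block_relations G).2.2.2
  rw [sub_eq_iff_eq_add] at h
  rw [h]; abel

/-- `ddᴴ = 1 + ccᴴ`. [cite: MoeglinVignerasWaldspurger1987, Ch. 1 I.17] -/
theorem d_mul_conjTranspose_d (G : UForm α β) : d G * (d G)ᴴ = 1 + c G * (c G)ᴴ := by
  have h := (block_relations' G).2.2.2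
  rw [sub_eq_iff_eq_add] at h
  rw [h]; abel

/-- `bᴴa = dᴴc`. [cite: MoeglinVignerasWaldspurger1987, Ch. 1 I.17] -/
theorem conjTranspose_b_mul_a (G : UForm α β) : (b G)ᴴ * a G = (d G)ᴴ * c G :=
  sub_eq_zero.1 (block_relations G).2.2.1

/-- `aᴴb = cᴴd`. [cite: MoeglinVignerasWaldspurger1987, Ch. 1 I.17] -/
theorem conjTranspose_a_mul_b (G : UForm α β) : (a G)ᴴ * b G = (c G)ᴴ * d G :=
  sub_eq_zero.1 (block_relations G).2.1

/-- A square matrix `X` with `XᴴX = 1 + YᴴY` is invertible. [cite: MoeglinVignerasWaldspurger1987, Ch. 1 I.17] -/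
theorem isUnit_of_conjTranspose_mul_self_eq {m k : Type*} [Fintype m] [DecidableEq m] [Fintype k]
    (X : Matrix m m ℂ) (Y : Matrix k m ℂ) (h : Xᴴ * X = 1 + Yᴴ * Y) : IsUnit X := by
  have hpd : (Xᴴ * X).PosDef := by
    rw [h]
    exact Matrix.PosDef.one.add_posSemidef (Matrix.posSemidef_conjTranspose_mul_self Y)
  have hdet : (Xᴴ * X).det ≠ 0 := hpd.det_pos.ne'
  rw [Matrix.det_mul, Matrix.det_conjTranspose] at hdet
  rw [Matrix.isUnit_iff_isUnit_det, isUnit_iff_ne_zero]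
  exact right_ne_zero_of_mul hdet

/-- **`a` is invertible.** [cite: MoeglinVignerasWaldspurger1987, Ch. 1 I.17] -/
theorem isUnit_a (G : UForm α β) : IsUnit (a G) :=
  isUnit_of_conjTranspose_mul_self_eq _ _ (conjTranspose_a_mul_a G)

/-- **`d` is invertible.** [cite: MoeglinVignerasWaldspurger1987, Ch. 1 I.17] -/
theorem isUnit_d (G : UForm α β) : IsUnit (d G) :=
  isUnit_of_conjTranspose_mul_self_eq _ _ (conjTranspose_d_mul_d G)

/-- `det a ≠ 0`. [cite: MoeglinVignerasWaldspurger1987, Ch. 1 I.17] -/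
theorem det_a_ne_zero (G : UForm α β) : (a G).det ≠ 0 :=
  ((Matrix.isUnit_iff_isUnit_det _).1 (isUnit_a G)).ne_zero

/-- `det d ≠ 0`. [cite: MoeglinVignerasWaldspurger1987, Ch. 1 I.17] -/
theorem det_d_ne_zero (G : UForm α β) : (d G).det ≠ 0 :=
  ((Matrix.isUnit_iff_isUnit_det _).1 (isUnit_d G)).ne_zero

/-- **`|det G| = 1`.** [cite: MoeglinVignerasWaldspurger1987, Ch. 1 I.17] -/
theorem norm_det_mat (G : UForm α β) : ‖(mat G).det‖ = 1 := by
  have h := congrArg Matrix.det (conjTranspose_mul_signForm_mul G)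
  rw [Matrix.det_mul, Matrix.det_mul, Matrix.det_conjTranspose] at h
  have hD : (signForm α β).det ≠ 0 := by
    rw [Matrix.det_fromBlocks_zero₂₁, Matrix.det_one, one_mul, Matrix.det_neg, Matrix.det_one, mul_one]
    exact pow_ne_zero _ (by norm_num)
  have h2 : star (mat G).det * (mat G).det = 1 := by
    have h' : star (mat G).det * (signForm α β).det * (mat G).det = 1 * (signForm α β).det := by
      rw [h, one_mul]
    rw [mul_right_comm] at h'
    exact mul_right_cancel₀ hD h'
  have h3 : ‖(mat G).det‖ ^ 2 = 1 := by
    have := congrArg Complex.re h2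
    rw [Complex.star_def, Complex.conj_mul', Complex.one_re] at this
    exact_mod_cast this
  nlinarith [norm_nonneg (mat G).det]

/-- `det G ≠ 0`. [cite: MoeglinVignerasWaldspurger1987, Ch. 1 I.17] -/
theorem det_mat_ne_zero (G : UForm α β) : (mat G).det ≠ 0 := fun h => by
  have h1 := norm_det_mat G
  rw [h, norm_zero] at h1
  exact zero_ne_one h1

/-- **`|det a| = |det d|`** (`det(aᴴa) = det(1 + cᴴc) = det(1 + ccᴴ) = det(ddᴴ)`). [cite: MoeglinVignerasWaldspurger1987, Ch. 1 I.17] -/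
theorem norm_det_a_eq_norm_det_d (G : UForm α β) : ‖(a G).det‖ = ‖(d G).det‖ := by
  have h1 : ((a G)ᴴ * a G).det = (d G * (d G)ᴴ).det := by
    rw [conjTranspose_a_mul_a, Matrix.det_one_add_mul_comm, ← d_mul_conjTranspose_d]
  rw [Matrix.det_mul, Matrix.det_mul, Matrix.det_conjTranspose, Matrix.det_conjTranspose,
    Complex.star_def, Complex.conj_mul', Complex.mul_conj'] at h1
  have h2 : ‖(a G).det‖ ^ 2 = ‖(d G).det‖ ^ 2 := by exact_mod_cast h1
  exact (pow_left_inj₀ (norm_nonneg _) (norm_nonneg _) two_ne_zero).1 h2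

/-! ## 2. The bounded domain and the Möbius action -/

omit [DecidableEq α] [Fintype β] in
variable (α β) in
/-- **The bounded domain `𝒟_{α,β} = {Z ∈ M_{α×β}(ℂ) : 1 − ZᴴZ ≻ 0}`** — the parameter space of the maximal negative
subspaces `V_Z⁻ = {(Zy, y)}` of the hermitian space `ℂ^α ⊕ ℂ^β` of signature `(|α|, |β|)`. [folklore] -/
def ball : Set (Matrix α β ℂ) := {Z | (1 - Zᴴ * Z).PosDef}

omit [DecidableEq α] [Fintype β] in
/-- Membership. [cite: Lee2004, §6.3 (6.27)–(6.30)] -/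
theorem mem_ball {Z : Matrix α β ℂ} : Z ∈ ball α β ↔ (1 - Zᴴ * Z).PosDef := Iff.rfl

omit [DecidableEq α] [Fintype β] in
/-- `0 ∈ 𝒟`. [cite: Lee2004, §6.3 (6.27)–(6.30)] -/
theorem zero_mem_ball : (0 : Matrix α β ℂ) ∈ ball α β := by
  rw [mem_ball, Matrix.conjTranspose_zero, Matrix.zero_mul, sub_zero]
  exact Matrix.PosDef.one

/-- The hermitian form `H(v) = vᴴ diag(1,−1) v` of `ℂ^{α ⊕ β}`. [folklore] -/
def hform (v : α ⊕ β → ℂ) : ℂ := star v ⬝ᵥ (signForm α β *ᵥ v)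

omit [Fintype α] [DecidableEq α] [Fintype β] [DecidableEq β] in
/-- `star` of a `Sum.elim` vector. [cite: Lee2004, §6.3 (6.27)–(6.30)] -/
theorem star_sum_elim (x : α → ℂ) (y : β → ℂ) : star (Sum.elim x y) = Sum.elim (star x) (star y) := by
  ext (i | j) <;> rfl

/-- `H((x, y)) = xᴴx − yᴴy`. [cite: Lee2004, §6.3 (6.27)–(6.30)] -/
theorem hform_sum_elim (x : α → ℂ) (y : β → ℂ) : hform (Sum.elim x y) = star x ⬝ᵥ x - star y ⬝ᵥ y := by
  rw [hform, Matrix.fromBlocks_mulVec, Sum.elim_comp_inl, Sum.elim_comp_inr, star_sum_elim,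
    sumElim_dotProduct_sumElim, Matrix.one_mulVec, Matrix.zero_mulVec, Matrix.zero_mulVec, add_zero,
    zero_add, Matrix.neg_mulVec, Matrix.one_mulVec, dotProduct_neg, sub_eq_add_neg]

/-- **`G` preserves the hermitian form**: `H(Gv) = H(v)`. [cite: MoeglinVignerasWaldspurger1987, Ch. 1 I.17] -/
theorem hform_mulVec (G : UForm α β) (v : α ⊕ β → ℂ) : hform (mat G *ᵥ v) = hform v := by
  rw [hform, hform, star_mulVec_dotProduct_mulVec_mulVec (mat G) (signForm α β) v v, conjTranspose_mul_signForm_mul]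

/-- The action of `G = (a b; c d)` on a block vector. [cite: Lee2004, §6.3 (6.27)–(6.30)] -/
theorem mat_mulVec_sum_elim (G : UForm α β) (x : α → ℂ) (y : β → ℂ) :
    mat G *ᵥ Sum.elim x y = Sum.elim (a G *ᵥ x + b G *ᵥ y) (c G *ᵥ x + d G *ᵥ y) := by
  rw [mat_eq_fromBlocks, Matrix.fromBlocks_mulVec, Sum.elim_comp_inl, Sum.elim_comp_inr]

/-- `H((Zy, y)) = −yᴴ(1 − ZᴴZ)y`. [cite: Lee2004, §6.3 (6.27)–(6.30)] -/
theorem hform_graph (Z : Matrix α β ℂ) (y : β → ℂ) :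
    hform (Sum.elim (Z *ᵥ y) y) = -(star y ⬝ᵥ ((1 - Zᴴ * Z) *ᵥ y)) := by
  rw [hform_sum_elim, Matrix.sub_mulVec, Matrix.one_mulVec, dotProduct_sub, ← Matrix.mulVec_mulVec,
    Matrix.dotProduct_mulVec (star y) Zᴴ, ← Matrix.star_mulVec]
  ring

/-- On the ball the graph vectors are strictly negative: `H((Zy, y)) < 0` for `y ≠ 0`. [cite: Lee2004, §6.3 (6.27)–(6.30)] -/
theorem hform_graph_neg {Z : Matrix α β ℂ} (hZ : Z ∈ ball α β) {y : β → ℂ} (hy : y ≠ 0) :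
    hform (Sum.elim (Z *ᵥ y) y) < 0 := by
  rw [hform_graph, neg_lt_zero]
  exact hZ.dotProduct_mulVec_pos hy

/-- **`cZ + d` is invertible for `Z` in the ball** (else `G` would map a strictly negative vector `(Zy, y)` to the
non-negative vector `((aZ+b)y, 0)`). [cite: Lee2004, §6.3 (6.27)–(6.30)] -/
theorem isUnit_cd (G : UForm α β) {Z : Matrix α β ℂ} (hZ : Z ∈ ball α β) : IsUnit (c G * Z + d G) := by
  rw [← Matrix.mulVec_injective_iff_isUnit, ← Matrix.coe_mulVecLin]
  refine (injective_iff_map_eq_zero (Matrix.mulVecLin (c G * Z + d G))).2 fun y hy => ?_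
  rw [Matrix.mulVecLin_apply] at hy
  by_contra hy0
  have hneg := hform_graph_neg hZ hy0
  have hG := hform_mulVec G (Sum.elim (Z *ᵥ y) y)
  rw [mat_mulVec_sum_elim, Matrix.mulVec_mulVec, Matrix.mulVec_mulVec, ← Matrix.add_mulVec, ← Matrix.add_mulVec,
    hy, hform_sum_elim, star_zero, zero_dotProduct, sub_zero] at hG
  have hnn : (0 : ℂ) ≤ star ((a G * Z + b G) *ᵥ y) ⬝ᵥ (a G * Z + b G) *ᵥ y := dotProduct_star_self_nonneg _
  rw [hG] at hnn
  exact lt_irrefl _ (hnn.trans_lt hneg)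

/-- `det(cZ + d) ≠ 0` on the ball. [cite: Lee2004, §6.3 (6.27)–(6.30)] -/
theorem det_cd_ne_zero (G : UForm α β) {Z : Matrix α β ℂ} (hZ : Z ∈ ball α β) : (c G * Z + d G).det ≠ 0 :=
  ((Matrix.isUnit_iff_isUnit_det _).1 (isUnit_cd G hZ)).ne_zero

/-- **The Möbius action** `G·Z = (aZ + b)(cZ + d)⁻¹`. [folklore] -/
def moebius (G : UForm α β) (Z : Matrix α β ℂ) : Matrix α β ℂ := (a G * Z + b G) * (c G * Z + d G)⁻¹

/-- `(G·Z)(cZ + d) = aZ + b` on the ball. [cite: Lee2004, §6.3 (6.27)–(6.30)] -/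
theorem moebius_mul_cd (G : UForm α β) {Z : Matrix α β ℂ} (hZ : Z ∈ ball α β) :
    moebius G Z * (c G * Z + d G) = a G * Z + b G := by
  rw [moebius, Matrix.nonsing_inv_mul_cancel_right _ _ ((Matrix.isUnit_iff_isUnit_det _).1 (isUnit_cd G hZ))]

/-- **`G·0 = b d⁻¹`.** [cite: Lee2004, §6.3 (6.27)–(6.30)] -/
theorem moebius_zero (G : UForm α β) : moebius G 0 = b G * (d G)⁻¹ := by
  rw [moebius, Matrix.mul_zero, zero_add, Matrix.mul_zero, zero_add]

/-- **`G` maps graph vectors to graph vectors**: `G (Zy, y) = ((G·Z) y′, y′)` with `y′ = (cZ + d) y`. [cite: Lee2004, §6.3 (6.27)–(6.30)] -/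
theorem mat_mulVec_graph (G : UForm α β) {Z : Matrix α β ℂ} (hZ : Z ∈ ball α β) (y : β → ℂ) :
    mat G *ᵥ Sum.elim (Z *ᵥ y) y =
      Sum.elim (moebius G Z *ᵥ ((c G * Z + d G) *ᵥ y)) ((c G * Z + d G) *ᵥ y) := by
  rw [mat_mulVec_sum_elim, Matrix.mulVec_mulVec, Matrix.mulVec_mulVec, Matrix.mulVec_mulVec, ← Matrix.add_mulVec,
    ← Matrix.add_mulVec, moebius_mul_cd G hZ]

/-- **The ball is stable**: `G·Z ∈ 𝒟`. [cite: Lee2004, §6.3 (6.27)–(6.30)] -/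
theorem moebius_mem (G : UForm α β) {Z : Matrix α β ℂ} (hZ : Z ∈ ball α β) : moebius G Z ∈ ball α β := by
  have hu : IsUnit (c G * Z + d G).det := (Matrix.isUnit_iff_isUnit_det _).1 (isUnit_cd G hZ)
  refine Matrix.PosDef.of_dotProduct_mulVec_pos ?_ fun w hw => ?_
  · exact Matrix.isHermitian_one.sub (Matrix.isHermitian_conjTranspose_mul_self _)
  · set y := (c G * Z + d G)⁻¹ *ᵥ w with hy
    have hwy : (c G * Z + d G) *ᵥ y = w := by
      rw [hy, Matrix.mulVec_mulVec, Matrix.mul_nonsing_inv _ hu, Matrix.one_mulVec]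
    have hy0 : y ≠ 0 := by
      rintro h0
      rw [h0, Matrix.mulVec_zero] at hwy
      exact hw hwy.symm
    have h1 := hform_mulVec G (Sum.elim (Z *ᵥ y) y)
    rw [mat_mulVec_graph G hZ, hwy, hform_graph, hform_graph, neg_inj] at h1
    rw [h1]
    exact hZ.dotProduct_mulVec_pos hy0

end UnitaryBall

end Literature.NumberTheory.Weil1964
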